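/-
Origin: expansion seat `planner-pub-hodgecm-pv10-0`, handover 2026-08-18T03:42:07Z (`HOME/pub-hodgecm-pv10/lean/Pv10/N31gBridge.lean`, md5 85105907, 27 lines);
landed by the gen-5 packager in gate run 19 as `HodgeCM/PerL34/N31gBridge.lean` (verbatim).
-/
/-
Copyright: HodgeCM publication cell, unit pub-hodgecm-pv10 (DAG-NODE PROVER #10), node N31g.
Origin: pub-hodgecm-pv10/lean/Pv10/N31gBridge.lean.  Suggested package target:
`HodgeCM/PerL34/N31gBridge.lean` (or appended to `CharsCore.lean` next to `N30_core_kronecker_holds` —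
packager's choice).  Imports only LANDED modules (gate run 18).
-/
import Summits.HodgeConjecture.HodgeCM.PerL34.Chars
import Summits.HodgeConjecture.HodgeCM.PerL34.NoSmallSubgroups

/-!
# N31g core — the carver's typed target, discharged by name

`HodgeCM.PerL34.N31g_core_noSmallSubgroups` (`PerL34/Chars.lean`, the carver's PRINT/Mathlib core of
node N31g: the circle has no small subgroups) is the SAME proposition as the one proved in
`PerL34/NoSmallSubgroups.lean` (`NoSmallSubgroups.N31g_core_noSmallSubgroups_holds`); this file records
the identification as a theorem whose type is literally the carver's declaration.
-/

set_option autoImplicit false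

namespace HodgeCM.PerL34

/-- Node N31g core (tex ll. 623–626), in the carver's typing: PROVED. -/
theorem N31g_core_noSmallSubgroups_holds : N31g_core_noSmallSubgroups :=
  NoSmallSubgroups.N31g_core_noSmallSubgroups_holds

end HodgeCM.PerL34
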